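import Summits.ResolutionOfSingularities.ResolutionOfSingularities.Theorems.FrobeniusLadderFRationalResolutionGaloisSymmetrizedPiece
import Mathlib.RingTheory.Ideal.Maximal
import Mathlib.RingTheory.Ideal.Maps
import HarnessLib

/-!
# Crux `FrobeniusLadder.FRationalResolution` (stmt-ResolutionOfSingularities-15317), line `redirect`,
# stub `stub_diagonalizableQuotientResolution` — the GALOIS TWISTS EXTENDED TO THE CHART `(B ⊗_K K') ⊗_B C`
# (typing of the comparison automorphisms `τ_σ` of the Galois route, memo MEMO-15317-leafhand2-g13 §4 (ii))

For `σ ∈ Aut_K(K')` the twist `1 ⊗ σ` of `B' = B ⊗_K K'` is `B`-linear, so it extends to the étale chart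
`C' = B' ⊗_B C` as `σ'' = (1 ⊗ σ) ⊗ 1` (`Algebra.TensorProduct.map (twist σ) (AlgHom.id B C)`). This file records the algebra
the next step of the Galois route needs (all `B' = B ⊗_K K'`, `C' = B' ⊗_B C`, twists written with `Algebra.TensorProduct.map`
exactly as in `…GaloisSymmetrizedPiece`):

* `chartTwist_tmul`, `chartTwist_includeRight`, `chartTwist_algebraMap` — `σ''(b' ⊗ c) = (1 ⊗ σ) b' ⊗ c`; `σ''` FIXES the chart
  factor `C` and restricts to `1 ⊗ σ` on `B'`.
* `chartTwist_mul`, `chartTwist_one`, `chartTwist_surjective` — multiplicativity, hence invertibility.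
* `comap_twist_inv_eq_map`, `comap_chartTwist_inv_eq_map` — `comap (1 ⊗ σ⁻¹) = map (1 ⊗ σ)` on ideals (both levels).
* `map_chartTwist_map_includeRight` — **the chart centre is twist-invariant**: `σ''(J C') = J C'` for every `J ⊆ C`.
* `map_chartTwist_map_algebraMap` — **twists of pieces extend to chart twists**: `((1 ⊗ σ) I) C' = σ''(I C')` for `I ⊆ B'`.
* `isMaximal_map_chartTwist`, `comap_algebraMap_map_chartTwist`, `comap_includeRight_map_chartTwist`,
  `residue_trivial_map_chartTwist` — `σ''` permutes the trivial-residue points: `σ''(𝔚)` is maximal, lies over `(1 ⊗ σ) 𝔔'`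
  (so over `𝔔'` for `σ` in the decomposition group) and over the same `𝔔 ⊆ C`, and again has trivial residue extension over `B'`.

Use (memo §2/§3b, and `…GaloisUpstairsPieceCover`): with the upstairs piece `I₁` and its chart equation `I₁ C'_G = J C'_G` at `𝔚`,
the twist to be shown Cartier is `((1 ⊗ σ) I₁) C' = σ''(I₁ C')`, i.e. the transport by `σ''` of `I₁ C'` read at the OTHER orbit point
`σ''⁻¹(𝔚)`; `σ''` is the chart-level avatar of `τ_σ`.

Honest label: plumbing/typing toward ONE leaf stub (no stub, crux or summit closed). No definitions, no named facts, no sorry.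
[cite: StacksProject, Tag 09EB]
-/

noncomputable section

-- single-problem summit: the doubled namespace component is forced
set_option linter.dupNamespace false

open scoped TensorProduct

namespace Summit.ResolutionOfSingularities.ResolutionOfSingularities.Theorems.FRationalResolution.GaloisTwistChart

variable {K B K' C : Type} [Field K] [CommRing B] [Algebra K B] [Field K'] [Algebra K K'] [CommRing C] [Algebra B C]

/-! ### The twists `1 ⊗ σ` of `B' = B ⊗_K K'` (complements to `…GaloisSymmetrizedPiece`) -/

/-- `(1 ⊗ σ⁻¹) ∘ (1 ⊗ σ) = id` pointwise. [cite: StacksProject, Tag 09EB] -/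
theorem twist_inv_apply (σ : K' ≃ₐ[K] K') (x : B ⊗[K] K') :
    Algebra.TensorProduct.map (AlgHom.id B B) ((σ⁻¹ : K' ≃ₐ[K] K') : K' →ₐ[K] K')
      (Algebra.TensorProduct.map (AlgHom.id B B) (σ : K' →ₐ[K] K') x) = x := by
  rw [← AlgHom.comp_apply, ← GaloisSymmetrizedPiece.twist_mul, inv_mul_cancel, GaloisSymmetrizedPiece.twist_one,
    AlgHom.id_apply]

/-- The twists are surjective. [cite: StacksProject, Tag 09EB] -/
theorem twist_surjective (σ : K' ≃ₐ[K] K') :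
    Function.Surjective (Algebra.TensorProduct.map (AlgHom.id B B) (σ : K' →ₐ[K] K')) := fun x =>
  ⟨Algebra.TensorProduct.map (AlgHom.id B B) ((σ⁻¹ : K' ≃ₐ[K] K') : K' →ₐ[K] K') x, by
    simpa only [inv_inv] using twist_inv_apply (B := B) σ⁻¹ x⟩

/-- On ideals of `B ⊗_K K'`: `comap (1 ⊗ σ⁻¹) = map (1 ⊗ σ)`. [cite: StacksProject, Tag 09EB] -/
theorem comap_twist_inv_eq_map (σ : K' ≃ₐ[K] K') (𝔞 : Ideal (B ⊗[K] K')) :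
    𝔞.comap (Algebra.TensorProduct.map (AlgHom.id B B) ((σ⁻¹ : K' ≃ₐ[K] K') : K' →ₐ[K] K')) =
      𝔞.map (Algebra.TensorProduct.map (AlgHom.id B B) (σ : K' →ₐ[K] K')) := by
  refine le_antisymm (fun x hx => ?_) ?_
  · rw [Ideal.mem_comap] at hx
    have h := Ideal.mem_map_of_mem (Algebra.TensorProduct.map (AlgHom.id B B) (σ : K' →ₐ[K] K')) hx
    simpa only [inv_inv] using (twist_inv_apply (B := B) σ⁻¹ x) ▸ h
  · rw [Ideal.map_le_iff_le_comap]
    intro x hx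
    rw [Ideal.mem_comap, Ideal.mem_comap, twist_inv_apply]
    exact hx

/-! ### The chart twists `σ'' = (1 ⊗ σ) ⊗ 1` of `C' = (B ⊗_K K') ⊗_B C` -/

/-- `σ''(b' ⊗ c) = (1 ⊗ σ) b' ⊗ c`. [cite: StacksProject, Tag 09EB] -/
theorem chartTwist_tmul (σ : K' ≃ₐ[K] K') (b' : B ⊗[K] K') (c : C) :
    Algebra.TensorProduct.map (Algebra.TensorProduct.map (AlgHom.id B B) (σ : K' →ₐ[K] K')) (AlgHom.id B C)
      (b' ⊗ₜ[B] c) = (Algebra.TensorProduct.map (AlgHom.id B B) (σ : K' →ₐ[K] K') b') ⊗ₜ[B] c := by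
  rw [Algebra.TensorProduct.map_tmul, AlgHom.id_apply]

/-- `σ''` fixes the chart factor: `σ''(1 ⊗ c) = 1 ⊗ c`. [cite: StacksProject, Tag 09EB] -/
theorem chartTwist_includeRight (σ : K' ≃ₐ[K] K') (c : C) :
    Algebra.TensorProduct.map (Algebra.TensorProduct.map (AlgHom.id B B) (σ : K' →ₐ[K] K')) (AlgHom.id B C)
      ((Algebra.TensorProduct.includeRight : C →ₐ[B] (B ⊗[K] K') ⊗[B] C) c) =
      (Algebra.TensorProduct.includeRight : C →ₐ[B] (B ⊗[K] K') ⊗[B] C) c := by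
  rw [Algebra.TensorProduct.includeRight_apply, chartTwist_tmul, map_one]

/-- `σ''` restricts to `1 ⊗ σ` on `B'`: `σ''(b' ⊗ 1) = (1 ⊗ σ) b' ⊗ 1`. [cite: StacksProject, Tag 09EB] -/
theorem chartTwist_algebraMap (σ : K' ≃ₐ[K] K') (b' : B ⊗[K] K') :
    Algebra.TensorProduct.map (Algebra.TensorProduct.map (AlgHom.id B B) (σ : K' →ₐ[K] K')) (AlgHom.id B C)
      (algebraMap (B ⊗[K] K') ((B ⊗[K] K') ⊗[B] C) b') =
      algebraMap (B ⊗[K] K') ((B ⊗[K] K') ⊗[B] C) (Algebra.TensorProduct.map (AlgHom.id B B) (σ : K' →ₐ[K] K') b') := by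
  rw [Algebra.TensorProduct.algebraMap_apply, Algebra.TensorProduct.algebraMap_apply, Algebra.algebraMap_self,
    RingHom.id_apply, RingHom.id_apply, chartTwist_tmul]

/-- The ring-hom form of `chartTwist_includeRight`. [cite: StacksProject, Tag 09EB] -/
theorem chartTwist_comp_includeRight (σ : K' ≃ₐ[K] K') :
    (Algebra.TensorProduct.map (Algebra.TensorProduct.map (AlgHom.id B B) (σ : K' →ₐ[K] K')) (AlgHom.id B C) :
        (B ⊗[K] K') ⊗[B] C →+* (B ⊗[K] K') ⊗[B] C).comp
      ((Algebra.TensorProduct.includeRight : C →ₐ[B] (B ⊗[K] K') ⊗[B] C) : C →+* (B ⊗[K] K') ⊗[B] C) =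
      ((Algebra.TensorProduct.includeRight : C →ₐ[B] (B ⊗[K] K') ⊗[B] C) : C →+* (B ⊗[K] K') ⊗[B] C) :=
  RingHom.ext fun c => chartTwist_includeRight σ c

/-- The ring-hom form of `chartTwist_algebraMap`. [cite: StacksProject, Tag 09EB] -/
theorem chartTwist_comp_algebraMap (σ : K' ≃ₐ[K] K') :
    (Algebra.TensorProduct.map (Algebra.TensorProduct.map (AlgHom.id B B) (σ : K' →ₐ[K] K')) (AlgHom.id B C) :
        (B ⊗[K] K') ⊗[B] C →+* (B ⊗[K] K') ⊗[B] C).comp (algebraMap (B ⊗[K] K') ((B ⊗[K] K') ⊗[B] C)) =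
      (algebraMap (B ⊗[K] K') ((B ⊗[K] K') ⊗[B] C)).comp
        (Algebra.TensorProduct.map (AlgHom.id B B) (σ : K' →ₐ[K] K') : B ⊗[K] K' →+* B ⊗[K] K') :=
  RingHom.ext fun b' => chartTwist_algebraMap σ b'

/-- Multiplicativity: `(τσ)'' = τ'' ∘ σ''`. [cite: StacksProject, Tag 09EB] -/
theorem chartTwist_mul (τ σ : K' ≃ₐ[K] K') :
    Algebra.TensorProduct.map (Algebra.TensorProduct.map (AlgHom.id B B) ((τ * σ : K' ≃ₐ[K] K') : K' →ₐ[K] K'))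
        (AlgHom.id B C) =
      (Algebra.TensorProduct.map (Algebra.TensorProduct.map (AlgHom.id B B) (τ : K' →ₐ[K] K')) (AlgHom.id B C)).comp
        (Algebra.TensorProduct.map (Algebra.TensorProduct.map (AlgHom.id B B) (σ : K' →ₐ[K] K')) (AlgHom.id B C)) := by
  rw [← Algebra.TensorProduct.map_comp, GaloisSymmetrizedPiece.twist_mul]
  rfl

/-- `1'' = id`. [cite: StacksProject, Tag 09EB] -/
theorem chartTwist_one :
    Algebra.TensorProduct.map (Algebra.TensorProduct.map (AlgHom.id B B) ((1 : K' ≃ₐ[K] K') : K' →ₐ[K] K'))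
        (AlgHom.id B C) = AlgHom.id B ((B ⊗[K] K') ⊗[B] C) := by
  rw [GaloisSymmetrizedPiece.twist_one, Algebra.TensorProduct.map_id]

/-- `(σ⁻¹)'' ∘ σ'' = id` pointwise. [cite: StacksProject, Tag 09EB] -/
theorem chartTwist_inv_apply (σ : K' ≃ₐ[K] K') (x : (B ⊗[K] K') ⊗[B] C) :
    Algebra.TensorProduct.map (Algebra.TensorProduct.map (AlgHom.id B B) ((σ⁻¹ : K' ≃ₐ[K] K') : K' →ₐ[K] K'))
        (AlgHom.id B C)
      (Algebra.TensorProduct.map (Algebra.TensorProduct.map (AlgHom.id B B) (σ : K' →ₐ[K] K')) (AlgHom.id B C) x) =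
      x := by
  rw [← AlgHom.comp_apply, ← chartTwist_mul, inv_mul_cancel, chartTwist_one, AlgHom.id_apply]

/-- The chart twists are surjective. [cite: StacksProject, Tag 09EB] -/
theorem chartTwist_surjective (σ : K' ≃ₐ[K] K') :
    Function.Surjective
      (Algebra.TensorProduct.map (Algebra.TensorProduct.map (AlgHom.id B B) (σ : K' →ₐ[K] K')) (AlgHom.id B C)) :=
  fun x => ⟨Algebra.TensorProduct.map (Algebra.TensorProduct.map (AlgHom.id B B) ((σ⁻¹ : K' ≃ₐ[K] K') : K' →ₐ[K] K'))
      (AlgHom.id B C) x, by simpa only [inv_inv] using chartTwist_inv_apply (B := B) (C := C) σ⁻¹ x⟩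

/-- On ideals of the chart: `comap (σ⁻¹)'' = map σ''`. [cite: StacksProject, Tag 09EB] -/
theorem comap_chartTwist_inv_eq_map (σ : K' ≃ₐ[K] K') (𝔄 : Ideal ((B ⊗[K] K') ⊗[B] C)) :
    𝔄.comap (Algebra.TensorProduct.map
        (Algebra.TensorProduct.map (AlgHom.id B B) ((σ⁻¹ : K' ≃ₐ[K] K') : K' →ₐ[K] K')) (AlgHom.id B C)) =
      𝔄.map (Algebra.TensorProduct.map (Algebra.TensorProduct.map (AlgHom.id B B) (σ : K' →ₐ[K] K'))
        (AlgHom.id B C)) := by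
  refine le_antisymm (fun x hx => ?_) ?_
  · rw [Ideal.mem_comap] at hx
    have h := Ideal.mem_map_of_mem
      (Algebra.TensorProduct.map (Algebra.TensorProduct.map (AlgHom.id B B) (σ : K' →ₐ[K] K')) (AlgHom.id B C)) hx
    simpa only [inv_inv] using (chartTwist_inv_apply (B := B) (C := C) σ⁻¹ x) ▸ h
  · rw [Ideal.map_le_iff_le_comap]
    intro x hx
    rw [Ideal.mem_comap, Ideal.mem_comap, chartTwist_inv_apply]
    exact hx

/-! ### Ideals: the chart centre is invariant, twists of pieces extend, points are permuted -/

/-- **The chart centre is twist-invariant**: `σ''(J C') = J C'` for every ideal `J ⊆ C`. [cite: StacksProject, Tag 09EB] -/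
theorem map_chartTwist_map_includeRight (σ : K' ≃ₐ[K] K') (J : Ideal C) :
    (J.map ((Algebra.TensorProduct.includeRight : C →ₐ[B] (B ⊗[K] K') ⊗[B] C) : C →+* (B ⊗[K] K') ⊗[B] C)).map
        (Algebra.TensorProduct.map (Algebra.TensorProduct.map (AlgHom.id B B) (σ : K' →ₐ[K] K')) (AlgHom.id B C)) =
      J.map ((Algebra.TensorProduct.includeRight : C →ₐ[B] (B ⊗[K] K') ⊗[B] C) : C →+* (B ⊗[K] K') ⊗[B] C) := by
  have h := Ideal.map_map (I := J)
    ((Algebra.TensorProduct.includeRight : C →ₐ[B] (B ⊗[K] K') ⊗[B] C) : C →+* (B ⊗[K] K') ⊗[B] C)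
    (Algebra.TensorProduct.map (Algebra.TensorProduct.map (AlgHom.id B B) (σ : K' →ₐ[K] K')) (AlgHom.id B C) :
      (B ⊗[K] K') ⊗[B] C →+* (B ⊗[K] K') ⊗[B] C)
  rw [chartTwist_comp_includeRight] at h
  exact h

/-- **Twists of pieces extend to chart twists**: `((1 ⊗ σ) I) C' = σ''(I C')` for every ideal `I ⊆ B'`.
[cite: StacksProject, Tag 09EB] -/
theorem map_chartTwist_map_algebraMap (σ : K' ≃ₐ[K] K') (I : Ideal (B ⊗[K] K')) :
    (I.map (algebraMap (B ⊗[K] K') ((B ⊗[K] K') ⊗[B] C))).map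
        (Algebra.TensorProduct.map (Algebra.TensorProduct.map (AlgHom.id B B) (σ : K' →ₐ[K] K')) (AlgHom.id B C)) =
      (I.map (Algebra.TensorProduct.map (AlgHom.id B B) (σ : K' →ₐ[K] K'))).map
        (algebraMap (B ⊗[K] K') ((B ⊗[K] K') ⊗[B] C)) := by
  have h := Ideal.map_map (I := I) (algebraMap (B ⊗[K] K') ((B ⊗[K] K') ⊗[B] C))
    (Algebra.TensorProduct.map (Algebra.TensorProduct.map (AlgHom.id B B) (σ : K' →ₐ[K] K')) (AlgHom.id B C) :
      (B ⊗[K] K') ⊗[B] C →+* (B ⊗[K] K') ⊗[B] C)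
  rw [chartTwist_comp_algebraMap, ← Ideal.map_map] at h
  exact h

/-- `σ''` of a maximal ideal is maximal. [cite: StacksProject, Tag 09EB] -/
theorem isMaximal_map_chartTwist (σ : K' ≃ₐ[K] K') (𝔚 : Ideal ((B ⊗[K] K') ⊗[B] C)) [h𝔚 : 𝔚.IsMaximal] :
    (𝔚.map (Algebra.TensorProduct.map (Algebra.TensorProduct.map (AlgHom.id B B) (σ : K' →ₐ[K] K'))
      (AlgHom.id B C))).IsMaximal := by
  rw [← comap_chartTwist_inv_eq_map]
  exact Ideal.comap_isMaximal_of_surjective _ (chartTwist_surjective σ⁻¹)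

/-- `σ''(𝔚)` lies over `(1 ⊗ σ)(𝔚 ∩ B')`; in particular over `𝔔'` when `𝔚` lies over `𝔔'` and `σ` is in the decomposition group
of `𝔔'`. [cite: StacksProject, Tag 09EB] -/
theorem comap_algebraMap_map_chartTwist (σ : K' ≃ₐ[K] K') (𝔚 : Ideal ((B ⊗[K] K') ⊗[B] C)) :
    (𝔚.map (Algebra.TensorProduct.map (Algebra.TensorProduct.map (AlgHom.id B B) (σ : K' →ₐ[K] K'))
      (AlgHom.id B C))).comap (algebraMap (B ⊗[K] K') ((B ⊗[K] K') ⊗[B] C)) =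
      (𝔚.comap (algebraMap (B ⊗[K] K') ((B ⊗[K] K') ⊗[B] C))).map
        (Algebra.TensorProduct.map (AlgHom.id B B) (σ : K' →ₐ[K] K')) := by
  rw [← comap_chartTwist_inv_eq_map, ← comap_twist_inv_eq_map]
  ext x
  simp only [Ideal.mem_comap, chartTwist_algebraMap]

/-- `σ''(𝔚)` lies over the same ideal of the chart factor `C` as `𝔚`. [cite: StacksProject, Tag 09EB] -/
theorem comap_includeRight_map_chartTwist (σ : K' ≃ₐ[K] K') (𝔚 : Ideal ((B ⊗[K] K') ⊗[B] C)) :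
    (𝔚.map (Algebra.TensorProduct.map (Algebra.TensorProduct.map (AlgHom.id B B) (σ : K' →ₐ[K] K'))
      (AlgHom.id B C))).comap
        ((Algebra.TensorProduct.includeRight : C →ₐ[B] (B ⊗[K] K') ⊗[B] C) : C →+* (B ⊗[K] K') ⊗[B] C) =
      𝔚.comap ((Algebra.TensorProduct.includeRight : C →ₐ[B] (B ⊗[K] K') ⊗[B] C) : C →+* (B ⊗[K] K') ⊗[B] C) := by
  rw [← comap_chartTwist_inv_eq_map]
  ext c
  simp only [Ideal.mem_comap, RingHom.coe_coe, chartTwist_includeRight]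

/-- **Trivial residue extension is preserved**: if every element of the chart is congruent mod `𝔚` to an element of `B'`, the
same holds mod `σ''(𝔚)`. [cite: StacksProject, Tag 09EB] -/
theorem residue_trivial_map_chartTwist (σ : K' ≃ₐ[K] K') (𝔚 : Ideal ((B ⊗[K] K') ⊗[B] C))
    (hres : ∀ x : (B ⊗[K] K') ⊗[B] C, ∃ b' : B ⊗[K] K', x - algebraMap (B ⊗[K] K') ((B ⊗[K] K') ⊗[B] C) b' ∈ 𝔚)
    (x : (B ⊗[K] K') ⊗[B] C) :
    ∃ b' : B ⊗[K] K', x - algebraMap (B ⊗[K] K') ((B ⊗[K] K') ⊗[B] C) b' ∈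
      𝔚.map (Algebra.TensorProduct.map (Algebra.TensorProduct.map (AlgHom.id B B) (σ : K' →ₐ[K] K'))
        (AlgHom.id B C)) := by
  obtain ⟨y, rfl⟩ := chartTwist_surjective (B := B) (C := C) σ x
  obtain ⟨b, hb⟩ := hres y
  refine ⟨Algebra.TensorProduct.map (AlgHom.id B B) (σ : K' →ₐ[K] K') b, ?_⟩
  rw [← chartTwist_algebraMap, ← map_sub]
  exact Ideal.mem_map_of_mem _ hb

/-- **The decomposition group permutes the trivial-residue points over `𝔔'`.** If `(1 ⊗ σ) 𝔔' = 𝔔'` and `𝔚` is a maximal ideal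
of the chart over `𝔔'` and over `𝔔 ⊆ C` with trivial residue extension over `B'`, then so is `σ''(𝔚)`.
[cite: StacksProject, Tag 09EB] -/
theorem map_chartTwist_point (σ : K' ≃ₐ[K] K') (𝔔' : Ideal (B ⊗[K] K'))
    (hσ : 𝔔'.map (Algebra.TensorProduct.map (AlgHom.id B B) (σ : K' →ₐ[K] K')) = 𝔔') (𝔔 : Ideal C)
    (𝔚 : Ideal ((B ⊗[K] K') ⊗[B] C)) [𝔚.IsMaximal]
    (h𝔚B : 𝔚.comap (algebraMap (B ⊗[K] K') ((B ⊗[K] K') ⊗[B] C)) = 𝔔')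
    (h𝔚C : 𝔚.comap ((Algebra.TensorProduct.includeRight : C →ₐ[B] (B ⊗[K] K') ⊗[B] C) :
      C →+* (B ⊗[K] K') ⊗[B] C) = 𝔔)
    (hres : ∀ x : (B ⊗[K] K') ⊗[B] C, ∃ b' : B ⊗[K] K', x - algebraMap (B ⊗[K] K') ((B ⊗[K] K') ⊗[B] C) b' ∈ 𝔚) :
    (𝔚.map (Algebra.TensorProduct.map (Algebra.TensorProduct.map (AlgHom.id B B) (σ : K' →ₐ[K] K'))
        (AlgHom.id B C))).IsMaximal ∧
      (𝔚.map (Algebra.TensorProduct.map (Algebra.TensorProduct.map (AlgHom.id B B) (σ : K' →ₐ[K] K'))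
        (AlgHom.id B C))).comap (algebraMap (B ⊗[K] K') ((B ⊗[K] K') ⊗[B] C)) = 𝔔' ∧
      (𝔚.map (Algebra.TensorProduct.map (Algebra.TensorProduct.map (AlgHom.id B B) (σ : K' →ₐ[K] K'))
        (AlgHom.id B C))).comap ((Algebra.TensorProduct.includeRight : C →ₐ[B] (B ⊗[K] K') ⊗[B] C) :
          C →+* (B ⊗[K] K') ⊗[B] C) = 𝔔 ∧
      ∀ x : (B ⊗[K] K') ⊗[B] C, ∃ b' : B ⊗[K] K', x - algebraMap (B ⊗[K] K') ((B ⊗[K] K') ⊗[B] C) b' ∈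
        𝔚.map (Algebra.TensorProduct.map (Algebra.TensorProduct.map (AlgHom.id B B) (σ : K' →ₐ[K] K'))
          (AlgHom.id B C)) :=
  ⟨isMaximal_map_chartTwist σ 𝔚, by rw [comap_algebraMap_map_chartTwist, h𝔚B, hσ],
    by rw [comap_includeRight_map_chartTwist, h𝔚C], residue_trivial_map_chartTwist σ 𝔚 hres⟩

end Summit.ResolutionOfSingularities.ResolutionOfSingularities.Theorems.FRationalResolution.GaloisTwistChart

end
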